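import Mathlib
import HarnessLib
import Summits.RiemannHypothesis.RiemannHypothesis.Theorems.IntegerScrewSmoothSectorDefs
import Summits.RiemannHypothesis.RiemannHypothesis.Theorems.SmoothSectorHardyDefs
import Summits.RiemannHypothesis.RiemannHypothesis.Theorems.ScrewLemmaKProfileBernoulli
import Summits.RiemannHypothesis.RiemannHypothesis.Theorems.ScrewLemmaKProfileBernoulliDefs

/-!
# `ψ(y) = O(y)` for `C²` data and Mellin convergence of the profile function (K♯ family, K1 inputs)

SECOND Euler–Maclaurin step: with `β(u) = y·b(fract(u/y))`, `b(w) = (w² − w)/2`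
(`Theorems/ScrewLemmaKProfileBernoulliDefs.lean`), one more integration by parts of the exact
formula `ψ(y) = ∫₀¹ (fract(u/y) − ½) g′(u) du` gives `ψ(y) = β(1)·g′(1) − ∫₀¹ β(u) g″(u) du`, hence
`|ψ(y)| ≤ (y/8)(|g′(1)| + ∫₀¹|g″|)` for `C²[0,1]` data (`g′ := derivWithin g [0,1]`, `g″ := deriv g′`):
`exists_profile_sub_plateau_le_mul`.  Consequence: the profile function
`H = ψ·1_(0,1) − h₀·1_[1,∞)` (`SmoothSectorHardy.profileFun`, verbatim the function inside item
stmt-RiemannHypothesis-22982 `ProfileMellinFormula`) is bounded, `O(y)` at `0⁺` and constant beyond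
`1`, so `MellinConvergent H w` for `−1 < Re w < 0` (`mellinConvergent_profileFun`), in particular on
the line `Re w = −½` for every `C²`-admissible generator (`mellinConvergent_profileFun_half`) — the
hypothesis under which K1a fires.  Also the leaf proviso `(h − h₀)²/y² ∈ L¹(0,1)` for `C²` data.

Ported verbatim (tree conventions: docstrings, split into ≤ 400-line files, `profileFun` reused from
`Theorems/SmoothSectorHardyDefs.lean`) from the desk file of rh-idea-5 g0 (family «LEMMA K♯»),
pub/ideators/rh-idea-5/ProfileBernoulli.lean v5 sha16 4e6baba130239d85 (2026-08-27), §§1–3.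
RH-free real analysis; RH is not proved by this and nothing here bears on the truth of RH.
-/

noncomputable section

set_option linter.dupNamespace false

namespace Summit.RiemannHypothesis.RiemannHypothesis.Theorems.IntegerScrew.ProfileBernoulli

open MeasureTheory Set intervalIntegral
open Summit.RiemannHypothesis.RiemannHypothesis.Theorems.IntegerScrew
open scoped BigOperators
open Summit.RiemannHypothesis.RiemannHypothesis.Theorems.SmoothSectorHardy (profileFun)

/-! ## `ψ(y) = O(y)` for `C²` data (second integration by parts) -/

/-- second-order exact formula: `ψ(y) = β(1)·g′(1) − ∫₀¹ β·g″` for `C²` data. -/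
theorem profile_sub_plateau_eq_C2 {g : ℝ → ℝ} (hC2 : ContDiffOn ℝ 2 g (Icc 0 1)) (h1 : g 1 = 0)
    (hI : ∫ u in (0:ℝ)..1, g u = 0) {y : ℝ} (hy : 0 < y) :
    latticeProfile g y - latticePlateau g
      = betaFun y 1 * derivWithin g (Icc 0 1) 1
        - ∫ u in (0:ℝ)..1, betaFun y u * deriv (derivWithin g (Icc 0 1)) u := by
  have hC1 : ContDiffOn ℝ 1 g (Icc 0 1) := hC2.of_le (by norm_num)
  set g₁ : ℝ → ℝ := derivWithin g (Icc 0 1) with hg₁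
  have hg₁C : ContDiffOn ℝ 1 g₁ (Icc 0 1) :=
    hC2.derivWithin (uniqueDiffOn_Icc zero_lt_one) (by norm_num)
  rw [profile_sub_plateau_eq hC1 h1 hI hy]
  -- replace `deriv g` by `g₁` inside the integral (they agree on (0,1))
  have hswap : (∫ u in (0:ℝ)..1, (Int.fract (u / y) - 1 / 2) * deriv g u)
      = ∫ u in (0:ℝ)..1, (Int.fract (u / y) - 1 / 2) * g₁ u := by
    rw [integral_of_le zero_le_one, integral_of_le zero_le_one,
      integral_Ioc_eq_integral_Ioo, integral_Ioc_eq_integral_Ioo]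
    refine setIntegral_congr_fun measurableSet_Ioo fun u hu => ?_
    simp only [hg₁, derivWithin_eq_deriv_of_mem hu]
  rw [hswap]
  -- integration by parts with right-derivatives
  have hu : ContinuousOn (betaFun y) (uIcc 0 1) := (continuous_betaFun hy).continuousOn
  have hv : ContinuousOn g₁ (uIcc 0 1) := by
    rw [uIcc_of_le zero_le_one]; exact hg₁C.continuousOn
  have huu' : ∀ x ∈ Ioo (min 0 1 : ℝ) (max 0 1),
      HasDerivWithinAt (betaFun y) (Int.fract (x / y) - 1 / 2) (Ioi x) x :=
    fun x _ => hasDerivWithinAt_betaFun hy x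
  have hvv' : ∀ x ∈ Ioo (min 0 1 : ℝ) (max 0 1), HasDerivWithinAt g₁ (deriv g₁ x) (Ioi x) x := by
    intro x hx
    rw [min_eq_left zero_le_one, max_eq_right zero_le_one] at hx
    exact (hasDerivAt_of_contDiffOn hg₁C hx).hasDerivWithinAt
  have hu' : IntervalIntegrable (fun x => Int.fract (x / y) - 1 / 2) volume 0 1 := by
    refine (intervalIntegrable_const (c := (1:ℝ))).mono_fun' ?_ ?_
    · exact ((measurable_fract.comp (measurable_id.div_const y)).sub measurable_const).aestronglyMeasurable
    · refine Filter.Eventually.of_forall fun u => ?_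
      simp only [Real.norm_eq_abs]
      rw [abs_le]
      constructor
      · linarith [Int.fract_nonneg (u / y)]
      · linarith [Int.fract_lt_one (u / y)]
  have hv' : IntervalIntegrable (deriv g₁) volume 0 1 := intervalIntegrable_deriv hg₁C
  have hibp := integral_mul_deriv_eq_deriv_mul_of_hasDeriv_right hu hv huu' hvv' hu' hv'
  -- hibp : ∫ β * g₁' = β 1 * g₁ 1 - β 0 * g₁ 0 - ∫ (fract - 1/2) * g₁
  rw [betaFun_zero] at hibp
  linarith

/-- THE `O(y)` BOUND: `|ψ(y)| ≤ (y/8)·(|g′(1)| + ∫₀¹ |g″|)` for `C²` data. -/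
theorem abs_profile_sub_plateau_le_mul {g : ℝ → ℝ} (hC2 : ContDiffOn ℝ 2 g (Icc 0 1)) (h1 : g 1 = 0)
    (hI : ∫ u in (0:ℝ)..1, g u = 0) {y : ℝ} (hy : 0 < y) :
    |latticeProfile g y - latticePlateau g|
      ≤ (y / 8) * (|derivWithin g (Icc 0 1) 1|
          + ∫ u in (0:ℝ)..1, |deriv (derivWithin g (Icc 0 1)) u|) := by
  have hg₁C : ContDiffOn ℝ 1 (derivWithin g (Icc 0 1)) (Icc 0 1) :=
    hC2.derivWithin (uniqueDiffOn_Icc zero_lt_one) (by norm_num)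
  rw [profile_sub_plateau_eq_C2 hC2 h1 hI hy]
  set g₂ : ℝ → ℝ := deriv (derivWithin g (Icc 0 1)) with hg₂
  have hint : IntervalIntegrable g₂ volume 0 1 := intervalIntegrable_deriv hg₁C
  have hA : |betaFun y 1 * derivWithin g (Icc 0 1) 1| ≤ (y / 8) * |derivWithin g (Icc 0 1) 1| := by
    rw [abs_mul]; gcongr; exact abs_betaFun_le hy 1
  have hB : |∫ u in (0:ℝ)..1, betaFun y u * g₂ u| ≤ (y / 8) * ∫ u in (0:ℝ)..1, |g₂ u| := by
    have hprod : IntervalIntegrable (fun u => betaFun y u * g₂ u) volume 0 1 :=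
      hint.continuousOn_mul (continuous_betaFun hy).continuousOn
    calc |∫ u in (0:ℝ)..1, betaFun y u * g₂ u|
        ≤ ∫ u in (0:ℝ)..1, |betaFun y u * g₂ u| := abs_integral_le_integral_abs zero_le_one
      _ ≤ ∫ u in (0:ℝ)..1, (y / 8) * |g₂ u| := by
          apply integral_mono_on zero_le_one hprod.abs (hint.abs.const_mul _)
          intro u _
          rw [abs_mul]
          gcongr
          exact abs_betaFun_le hy u
      _ = (y / 8) * ∫ u in (0:ℝ)..1, |g₂ u| := intervalIntegral.integral_const_mul _ _
  calc |betaFun y 1 * derivWithin g (Icc 0 1) 1 - ∫ u in (0:ℝ)..1, betaFun y u * g₂ u|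
      ≤ |betaFun y 1 * derivWithin g (Icc 0 1) 1| + |∫ u in (0:ℝ)..1, betaFun y u * g₂ u| :=
        abs_sub _ _
    _ ≤ (y / 8) * |derivWithin g (Icc 0 1) 1| + (y / 8) * ∫ u in (0:ℝ)..1, |g₂ u| := add_le_add hA hB
    _ = (y / 8) * (|derivWithin g (Icc 0 1) 1| + ∫ u in (0:ℝ)..1, |g₂ u|) := by ring

/-- Packaged: for `C²` data there is `C` with `|ψ(y)| ≤ C·y` for all `y > 0`. -/
theorem exists_profile_sub_plateau_le_mul {g : ℝ → ℝ} (hC2 : ContDiffOn ℝ 2 g (Icc 0 1)) (h1 : g 1 = 0)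
    (hI : ∫ u in (0:ℝ)..1, g u = 0) :
    ∃ C : ℝ, 0 ≤ C ∧ ∀ y : ℝ, 0 < y → |latticeProfile g y - latticePlateau g| ≤ C * y := by
  refine ⟨(1 / 8) * (|derivWithin g (Icc 0 1) 1|
      + ∫ u in (0:ℝ)..1, |deriv (derivWithin g (Icc 0 1)) u|), ?_, fun y hy => ?_⟩
  · have : 0 ≤ ∫ u in (0:ℝ)..1, |deriv (derivWithin g (Icc 0 1)) u| :=
      intervalIntegral.integral_nonneg zero_le_one fun u _ => abs_nonneg _
    positivity
  · have := abs_profile_sub_plateau_le_mul hC2 h1 hI hy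
    linarith [this]


/-! ## Mellin convergence of the profile function on `−1 < Re w < 0` for `C²` data -/

/-- uniform bound `‖H(y)‖ ≤ ½∫₀¹|g′| + |h₀|` for `y > 0`. [folklore] -/
theorem norm_profileFun_le {g : ℝ → ℝ} (hC : ContDiffOn ℝ 1 g (Icc 0 1)) (h1 : g 1 = 0)
    (hI : ∫ u in (0:ℝ)..1, g u = 0) {y : ℝ} (hy : 0 < y) :
    ‖profileFun g y‖ ≤ (1 / 2) * (∫ u in (0:ℝ)..1, |deriv g u|) + |latticePlateau g| := by
  have hψ := abs_profile_sub_plateau_le hC h1 hI hy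
  simp only [profileFun, Complex.norm_real, Real.norm_eq_abs]
  have hA : |(Ioo (0:ℝ) 1).indicator (fun y => latticeProfile g y - latticePlateau g) y|
      ≤ (1 / 2) * ∫ u in (0:ℝ)..1, |deriv g u| := by
    by_cases hy1 : y ∈ Ioo (0:ℝ) 1
    · rw [Set.indicator_of_mem hy1]; exact hψ
    · rw [Set.indicator_of_notMem hy1, abs_zero]
      have : 0 ≤ ∫ u in (0:ℝ)..1, |deriv g u| :=
        intervalIntegral.integral_nonneg zero_le_one fun u _ => abs_nonneg _
      positivity
  have hB : |(Ici (1:ℝ)).indicator (fun _ => latticePlateau g) y| ≤ |latticePlateau g| := by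
    by_cases hy1 : y ∈ Ici (1:ℝ)
    · rw [Set.indicator_of_mem hy1]
    · rw [Set.indicator_of_notMem hy1, abs_zero]; exact abs_nonneg _
  exact (abs_sub _ _).trans (add_le_add hA hB)

/-- MELLIN CONVERGENCE of the profile function on `−1 < Re w < 0` for `C²` data. -/
theorem mellinConvergent_profileFun {g : ℝ → ℝ} (hC2 : ContDiffOn ℝ 2 g (Icc 0 1)) (h1 : g 1 = 0)
    (hI : ∫ u in (0:ℝ)..1, g u = 0) {w : ℂ} (hw1 : -1 < w.re) (hw2 : w.re < 0) :
    MellinConvergent (profileFun g) w := by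
  have hC1 : ContDiffOn ℝ 1 g (Icc 0 1) := hC2.of_le (by norm_num)
  obtain ⟨C, hC0, hCy⟩ := exists_profile_sub_plateau_le_mul hC2 h1 hI
  -- measurable model
  set Hm : ℝ → ℂ := fun y =>
    (((Ioo (0:ℝ) 1).indicator (psiInt g) y - (Ici (1:ℝ)).indicator (fun _ => latticePlateau g) y : ℝ) : ℂ)
    with hHm
  have hHm_meas : Measurable Hm := by
    apply Complex.measurable_ofReal.comp
    exact ((stronglyMeasurable_psiInt g).measurable.indicator measurableSet_Ioo).sub
      (measurable_const.indicator measurableSet_Ici)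
  have hEq : ∀ y, 0 < y → Hm y = profileFun g y := by
    intro y hy
    simp only [profileFun, hHm]
    by_cases hy1 : y ∈ Ioo (0:ℝ) 1
    · rw [Set.indicator_of_mem hy1, Set.indicator_of_mem hy1, psiInt_eq hC1 h1 hI hy]
    · rw [Set.indicator_of_notMem hy1, Set.indicator_of_notMem hy1]
  -- local integrability on (0, ∞)
  have hloc : LocallyIntegrableOn (profileFun g) (Ioi 0) := by
    rw [locallyIntegrableOn_iff isOpen_Ioi.isLocallyClosed]
    intro k hk hkc
    have hmeas : AEStronglyMeasurable (profileFun g) (volume.restrict k) := by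
      refine hHm_meas.aestronglyMeasurable.congr ?_
      exact (ae_restrict_mem hkc.measurableSet).mono fun y hy => hEq y (hk hy)
    exact IntegrableOn.of_bound hkc.measure_lt_top hmeas _
      ((ae_restrict_mem hkc.measurableSet).mono fun y hy => norm_profileFun_le hC1 h1 hI (hk hy))
  -- behaviour at +∞ : constant `−h₀`
  have htop : (profileFun g) =O[Filter.atTop] (fun y : ℝ => y ^ (-(0:ℝ))) := by
    apply Asymptotics.IsBigO.of_bound |latticePlateau g|
    filter_upwards [Filter.eventually_ge_atTop (1:ℝ)] with y hy
    have hy1 : y ∉ Ioo (0:ℝ) 1 := fun h => (not_lt.mpr hy) h.2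
    have hy2 : y ∈ Ici (1:ℝ) := hy
    simp only [profileFun, Set.indicator_of_notMem hy1, Set.indicator_of_mem hy2, neg_zero,
      Real.rpow_zero, norm_one, mul_one, zero_sub, Complex.norm_real, Real.norm_eq_abs, abs_neg]
    simp
  -- behaviour at 0⁺ : `O(y)`
  have hbot : (profileFun g) =O[nhdsWithin 0 (Ioi 0)] (fun y : ℝ => y ^ (-(-1:ℝ))) := by
    apply Asymptotics.IsBigO.of_bound C
    filter_upwards [Ioo_mem_nhdsGT zero_lt_one] with y hy
    have hy2 : y ∉ Ici (1:ℝ) := fun h => (not_lt.mpr h) hy.2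
    simp only [profileFun, Set.indicator_of_mem hy, Set.indicator_of_notMem hy2, sub_zero, neg_neg,
      Real.rpow_one, Complex.norm_real, Real.norm_eq_abs, abs_of_pos hy.1]
    exact hCy y hy.1
  exact mellinConvergent_of_isBigO_rpow hloc htop (by simpa using hw2) hbot (by simpa using hw1)

/-- the same, for an admissible generator of class `C²`, on the line `Re w = −½`. -/
theorem mellinConvergent_profileFun_half {g : ℝ → ℝ} (hg : SmoothSectorAdmissible g)
    (hC2 : ContDiffOn ℝ 2 g (Icc 0 1)) (t : ℝ) :
    MellinConvergent (profileFun g) (-(1 / 2 : ℂ) + t * Complex.I) :=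
  mellinConvergent_profileFun hC2 hg.2.1 hg.2.2.1 (by norm_num) (by norm_num)


end Summit.RiemannHypothesis.RiemannHypothesis.Theorems.IntegerScrew.ProfileBernoulli

end
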